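import Literature.Topology.FourManifolds.KirbyMovesSlideEndDefs
import HarnessLib

/-!
# Normalising the band end: the derivative of the thickening coordinates at the edge

Topic `Literature/Topology/FourManifolds`; fact seat `provefact-IsStrictHandleSlide.isSurgery`
(R. C. Kirby, *The Topology of 4-Manifolds*, LNM 1374 (1989), Ch. I §4; remaining content: the
named fact (S) `Literature.Topology.FourManifolds.FramedLink.IsStrictHandleSlide.slideModel`).
The thickening of the band end (`KirbyMovesSlideEndDefs.lean`) is `ν ∘ (circlePt × id) ∘ Ξ₀` with
the **thickening coordinates** `Ξ₀ (x, z) = (baseLift x, tubeNormal x + z • e_y) ∈ ℝ × ℝ²`. This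
file computes the derivative of `Ξ₀` at the edge points `((1, y), 0)` and shows that it is
injective as soon as the band leaves the push-off radially (the output of step A,
`BandCore.exists_stepA`: `D W (1, y) (1, 0) = -c • e₀`, `c > 0`). Proved here, no definitions,
no named facts:

* `BandCore.fderiv_tubeNormal_pt2_one_vertical` — `D W (1, y) (0, 1) = 0` (`W ≡ e₀` on the edge);
* `BandCore.fderiv_baseLift_pt2_one_vertical` — `D baseLift (1, y) (0, 1) = thetaB′ y`;
* `BandCore.hasFDerivAt_thickeningCoord` — the derivative of `Ξ₀` at `((1, y), 0)`;
* `BandCore.injective_fderiv_thickeningCoord` — it is injective when `D W (1, y) (1, 0) = -c • e₀`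
  with `c ≠ 0`.

## References

* R. C. Kirby, *The Topology of 4-Manifolds*, LNM 1374, Springer (1989), Ch. I §4. [Kirby1989]
* A. Kosinski, *Differential Manifolds* (1993), Ch. III, Thm. (3.5). [Kosinski1993]
-/

open scoped Manifold ContDiff Topology
open Function Set Metric

noncomputable section

namespace Literature.Topology.FourManifolds

namespace BandCore

variable [Knot.TubularNbhd.SmoothnessFacts] {A Kj : Knot} (ν : Knot.TubularNbhd Kj)
  {avoid : Set (Metric.sphere (0 : EuclideanSpace ℝ (Fin 4)) 1)} (b : BandCore A ν.pushOff avoid)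

omit [Knot.TubularNbhd.SmoothnessFacts] in
/-- The vertical line through the edge point: `y' ↦ (1, y')` has derivative `(0, 1)`. [folklore] -/
theorem hasDerivAt_pt2_one_line (y : ℝ) : HasDerivAt (fun y' : ℝ ↦ (pt2 1 y' : EuclideanSpace ℝ (Fin 2))) (pt2 0 1) y := by
  have := hasDerivAt_pt2 (hasDerivAt_const y (1 : ℝ)) (hasDerivAt_id y)
  simpa using this

/-- **`D W (1, y) (0, 1) = 0`**: the normal coordinate is constant (`= e₀`) along the edge. [folklore] -/
theorem fderiv_tubeNormal_pt2_one_vertical {y : ℝ} (hy : y ∈ Ioo (10⁻¹ : ℝ) (9 / 10)) :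
    fderiv ℝ (b.tubeNormal ν) (pt2 1 y) (pt2 0 1) = 0 := by
  have hO := b.isOpen_preimage_range_tube ν
  have hOn : b.band ⁻¹' range ⇑ν ∈ 𝓝 (pt2 1 y : EuclideanSpace ℝ (Fin 2)) :=
    hO.mem_nhds (b.band_pt2_one_mem_range ν (Ioo_subset_Icc_self hy))
  have hWs : ContDiffAt ℝ ∞ (b.tubeNormal ν) (pt2 1 y) := (b.contDiffOn_tubeNormal'' ν).contDiffAt hOn
  have hWd : HasFDerivAt (b.tubeNormal ν) (fderiv ℝ (b.tubeNormal ν) (pt2 1 y)) (pt2 1 y) :=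
    (hWs.differentiableAt (by simp)).hasFDerivAt
  have h1 : HasDerivAt ((b.tubeNormal ν) ∘ fun y' : ℝ ↦ (pt2 1 y' : EuclideanSpace ℝ (Fin 2)))
      (fderiv ℝ (b.tubeNormal ν) (pt2 1 y) (pt2 0 1)) y := hWd.comp_hasDerivAt y (hasDerivAt_pt2_one_line y)
  have h2 : HasDerivAt ((b.tubeNormal ν) ∘ fun y' : ℝ ↦ (pt2 1 y' : EuclideanSpace ℝ (Fin 2))) 0 y := by
    refine (hasDerivAt_const y framingBaseVector).congr_of_eventuallyEq ?_
    filter_upwards [Ioo_mem_nhds hy.1 hy.2] with y' hy'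
    exact b.tubeNormal_pt2_one ν (Ioo_subset_Icc_self hy')
  exact h1.unique h2

/-- **`D baseLift (1, y) (0, 1) = thetaB′ y`**: along the edge the base lift is `thetaB`. [folklore] -/
theorem fderiv_baseLift_pt2_one_vertical {y : ℝ} (hy : y ∈ Ioo (10⁻¹ : ℝ) (9 / 10)) :
    fderiv ℝ (b.baseLift ν) (pt2 1 y) (pt2 0 1) = deriv b.thetaB y := by
  have hD := b.isOpen_baseLiftDom' ν
  have hDn : b.baseLiftDom ν ∈ 𝓝 (pt2 1 y : EuclideanSpace ℝ (Fin 2)) := hD.mem_nhds (b.pt2_one_mem_baseLiftDom' ν hy)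
  have hΘs : ContDiffAt ℝ ∞ (b.baseLift ν) (pt2 1 y) := (b.contDiffOn_baseLift' ν).contDiffAt hDn
  have hΘd : HasFDerivAt (b.baseLift ν) (fderiv ℝ (b.baseLift ν) (pt2 1 y)) (pt2 1 y) :=
    (hΘs.differentiableAt (by simp)).hasFDerivAt
  have h1 : HasDerivAt ((b.baseLift ν) ∘ fun y' : ℝ ↦ (pt2 1 y' : EuclideanSpace ℝ (Fin 2)))
      (fderiv ℝ (b.baseLift ν) (pt2 1 y) (pt2 0 1)) y := hΘd.comp_hasDerivAt y (hasDerivAt_pt2_one_line y)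
  have h2 : HasDerivAt ((b.baseLift ν) ∘ fun y' : ℝ ↦ (pt2 1 y' : EuclideanSpace ℝ (Fin 2))) (deriv b.thetaB y) y := by
    have hth : HasDerivAt b.thetaB (deriv b.thetaB y) y :=
      ((b.contDiffAt_thetaB hy).differentiableAt (by simp)).hasDerivAt
    refine hth.congr_of_eventuallyEq ?_
    filter_upwards [Ioo_mem_nhds hy.1 hy.2] with y' hy'
    exact b.baseLift_pt2_one' ν (Ioo_subset_Icc_self hy')
  exact h1.unique h2

/-- **The derivative of the thickening coordinates** `Ξ₀ (x, z) = (baseLift x, W x + z • e_y)` at a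
point `(x, z)` with `x` in the domain of the base lift: `(v, ζ) ↦ (D baseLift x v, D W x v + ζ • e_y)`.
[folklore] -/
theorem hasFDerivAt_thickeningCoord {x : EuclideanSpace ℝ (Fin 2)} (hx : x ∈ b.baseLiftDom ν) (z : ℝ) :
    HasFDerivAt (fun p : EuclideanSpace ℝ (Fin 2) × ℝ ↦
        ((b.baseLift ν p.1, b.tubeNormal ν p.1 + p.2 • EuclideanSpace.single (1 : Fin 2) (1 : ℝ)) : ℝ × EuclideanSpace ℝ (Fin 2)))
      (((fderiv ℝ (b.baseLift ν) x).comp (ContinuousLinearMap.fst ℝ _ ℝ)).prod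
        ((fderiv ℝ (b.tubeNormal ν) x).comp (ContinuousLinearMap.fst ℝ _ ℝ) +
          (ContinuousLinearMap.snd ℝ (EuclideanSpace ℝ (Fin 2)) ℝ).smulRight (EuclideanSpace.single (1 : Fin 2) (1 : ℝ))))
      (x, z) := by
  have hD := b.isOpen_baseLiftDom' ν
  have hO := b.isOpen_preimage_range_tube ν
  have hΘ : HasFDerivAt (b.baseLift ν) (fderiv ℝ (b.baseLift ν) x) x :=
    (((b.contDiffOn_baseLift' ν).contDiffAt (hD.mem_nhds hx)).differentiableAt (by simp)).hasFDerivAt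
  have hW : HasFDerivAt (b.tubeNormal ν) (fderiv ℝ (b.tubeNormal ν) x) x :=
    (((b.contDiffOn_tubeNormal'' ν).contDiffAt (hO.mem_nhds hx.1)).differentiableAt (by simp)).hasFDerivAt
  have h1 : HasFDerivAt ((b.baseLift ν) ∘ (Prod.fst : EuclideanSpace ℝ (Fin 2) × ℝ → EuclideanSpace ℝ (Fin 2)))
      ((fderiv ℝ (b.baseLift ν) x).comp (ContinuousLinearMap.fst ℝ _ ℝ)) (x, z) :=
    HasFDerivAt.comp (x, z) hΘ hasFDerivAt_fst
  have h2 : HasFDerivAt ((b.tubeNormal ν) ∘ (Prod.fst : EuclideanSpace ℝ (Fin 2) × ℝ → EuclideanSpace ℝ (Fin 2)))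
      ((fderiv ℝ (b.tubeNormal ν) x).comp (ContinuousLinearMap.fst ℝ _ ℝ)) (x, z) :=
    HasFDerivAt.comp (x, z) hW hasFDerivAt_fst
  have h3 : HasFDerivAt (fun p : EuclideanSpace ℝ (Fin 2) × ℝ ↦ p.2 • EuclideanSpace.single (1 : Fin 2) (1 : ℝ))
      ((ContinuousLinearMap.snd ℝ (EuclideanSpace ℝ (Fin 2)) ℝ).smulRight (EuclideanSpace.single (1 : Fin 2) (1 : ℝ))) (x, z) :=
    (hasFDerivAt_snd (𝕜 := ℝ) (E := EuclideanSpace ℝ (Fin 2)) (F := ℝ) (p := (x, z))).smul_const _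
  exact h1.prodMk (h2.add h3)

/-- **Injectivity of the derivative of the thickening coordinates at an edge point**, when the
band leaves the push-off radially there: if `D W (1, y) (1, 0) = -c • e₀` with `c ≠ 0`
(`y ∈ (1/10, 9/10)`), the linear map `(v, ζ) ↦ (D baseLift (1, y) v, D W (1, y) v + ζ • e_y)` is
injective. [folklore] -/
theorem injective_fderiv_thickeningCoord {y : ℝ} (hy : y ∈ Ioo (10⁻¹ : ℝ) (9 / 10)) {c : ℝ} (hc : c ≠ 0)
    (hA : fderiv ℝ (b.tubeNormal ν) (pt2 1 y) (pt2 1 0) = (-c) • framingBaseVector) :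
    Injective (((fderiv ℝ (b.baseLift ν) (pt2 1 y)).comp (ContinuousLinearMap.fst ℝ _ ℝ)).prod
        ((fderiv ℝ (b.tubeNormal ν) (pt2 1 y)).comp (ContinuousLinearMap.fst ℝ _ ℝ) +
          (ContinuousLinearMap.snd ℝ (EuclideanSpace ℝ (Fin 2)) ℝ).smulRight (EuclideanSpace.single (1 : Fin 2) (1 : ℝ)))) := by
  set LΘ := fderiv ℝ (b.baseLift ν) (pt2 1 y) with hLΘ
  set LW := fderiv ℝ (b.tubeNormal ν) (pt2 1 y) with hLW
  have hΘ1 : LΘ (pt2 0 1) = deriv b.thetaB y := b.fderiv_baseLift_pt2_one_vertical ν hy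
  have hW1 : LW (pt2 0 1) = 0 := b.fderiv_tubeNormal_pt2_one_vertical ν hy
  have hW0 : LW (pt2 1 0) = (-c) • framingBaseVector := hA
  have hth : deriv b.thetaB y ≠ 0 := (b.deriv_thetaB_neg hy).ne
  refine (injective_iff_map_eq_zero _).2 fun p hp ↦ ?_
  obtain ⟨v, ζ⟩ := p
  -- decompose `v = v₀ (1,0) + v₁ (0,1)`
  have hv : v = (v 0) • (pt2 1 0 : EuclideanSpace ℝ (Fin 2)) + (v 1) • pt2 0 1 := by
    ext i; fin_cases i <;> simp [pt2]
  have h1 := congrArg Prod.fst hp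
  have h2 := congrArg Prod.snd hp
  simp only [ContinuousLinearMap.prod_apply, ContinuousLinearMap.coe_comp, comp_apply,
    ContinuousLinearMap.coe_fst', add_apply, ContinuousLinearMap.smulRight_apply,
    ContinuousLinearMap.coe_snd', Prod.fst_zero, Prod.snd_zero] at h1 h2
  rw [hv, map_add, map_smul, map_smul, hΘ1] at h1
  rw [hv, map_add, map_smul, map_smul, hW0, hW1, smul_zero, add_zero] at h2
  -- from `h2`: `v 0 • (-c • e₀) + ζ • e_y = 0` ⇒ `v 0 = 0`, `ζ = 0`
  have hfb : framingBaseVector = (1 / 2 : ℝ) • EuclideanSpace.single (0 : Fin 2) (1 : ℝ) := by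
    ext i; fin_cases i <;> simp [framingBaseVector]
  rw [hfb] at h2
  have e0 := congrArg (fun w : EuclideanSpace ℝ (Fin 2) ↦ w 0) h2
  have e1 := congrArg (fun w : EuclideanSpace ℝ (Fin 2) ↦ w 1) h2
  simp at e0 e1
  have hv0 : v 0 = 0 := by
    rcases e0 with h | h
    · exact h
    · exact absurd h hc
  rw [hv0, zero_smul, zero_add, smul_eq_mul] at h1
  have hv1 : v 1 = 0 := by
    rcases mul_eq_zero.1 h1 with h | h
    · exact h
    · exact absurd h hth
  have hv00 : v = 0 := by rw [hv, hv0, hv1, zero_smul, zero_smul, add_zero]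
  simp only [hv00, e1, Prod.mk_eq_zero, and_self]

end BandCore

end Literature.Topology.FourManifolds
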